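import Summits.BirchSwinnertonDyer.Rank1Residual.Iwasawa.MuZeroQuotientCard
import Summits.BirchSwinnertonDyer.Rank1Residual.Additive.CongruentPartnerBudgetSchema
import HarnessLib

/-!
# The Route-G budget schema with NO folklore binder: DISCHARGE of cc-typer-2's typed inputs (L1)
# `card_quotient_eq_pow_lambdaInvariant` and (L2) `card_quotient_eq_card_selmer_torsion`
# (cell `b2b-bsdres`, team n1011, seat p12 (gen 3); row T-E3gX3-bud-L1/L2, ON-CALL idle-rule claim
# ratified by lead GEN 6 R5-36; schema `Additive/CongruentPartnerBudgetSchema.lean` by cc-typer-2 on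
# route planner 2's sketch, ROUTE-2 II.14.2)

HONEST FRAMING (cell `b2b-bsdres`, run/shared/lean/b2b/bsd-rank1-residual/, verbatim in every
file): the goal of the cell is to DELETE the COMBINATION-SHAPED residual classes of the
Birch–Swinnerton-Dyer formula for ALL analytic-rank `≤ 1` elliptic curves over `ℚ` — "full BSD
formula for every rank `≤ 1` curve in class `C`" assembled STRICTLY from published theorems — so
that the rank-`≤ 1` remainder becomes exactly the CONSTRUCTION-SHAPED classes, which are TYPED
(missing-input `Prop`s), NOT attempted. This is not "finishing BSD". THIS FILE: theorems only; NO
named fact, NO definition, nothing booked, no label / mark touched. The algebra lives in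
`Iwasawa/MuZeroQuotientCard.lean` (generic, curve-free); here it is applied to cc-typer-2's typed
inputs BY NAME: **both folklore binders (L1) and (L2) of the T-E3gX3-bud budget schema become
THEOREMS**, so `budgetLeLambdaAt_of_noFiniteSubmodule_of_residualSurj` keeps EXACTLY its two
arithmetic inputs — (b′) `NoFiniteSubmoduleAt p W` (the Greenberg 1999 Prop. 4.14 record BY NAME on
rows with `p ∤ #E(ℚ)_tors`) and the residual count `ResidualSelmerRankGeAt p W b` (flag
`X3-budget-unprinted` on reducible rows; EPW 2006 Cor. 3.2.5 on irreducible rows). X3 / X4 stay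
CONSTRUCTION-SHAPED; the budget rows stay EVIDENCE-conditional on that ONE input.

## Contents

* §1 (L1) `card_quotient_eq_pow_lambdaInvariant_holds (M) : card_quotient_eq_pow_lambdaInvariant p M`
  (`μ = 0 ⟹` f.g. over `ℤ_p` ⟹ free of rank `λ` ⟹ `#(M/𝔭M) = p^λ`).
* §2 (L2) `card_quotient_eq_card_selmer_torsion_holds (W κ γ) : card_quotient_eq_card_selmer_torsion p W κ γ`
  (`X/𝔭X = X/pX ≅ Hom(Sel_∞, ℚ/ℤ)/p ≅ Hom(Sel_∞[p], ℚ/ℤ)`, `#Hom(A, ℚ/ℤ) = #A`; no `hγ` needed).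
* §3 the schema with the binders supplied: `budgetLeLambdaAt_of_noFiniteSubmodule_of_residualRankGe'`
  (hnf hres), `budgetLeLambdaAt_of_noFiniteSubmodule_of_residualSurj'` (hL2 hnf hres) /
  `…_of_residualSurj''` (hnf hres), `budgetLeLambdaAt_of_prop414_of_residualSurj'` (h414 htors hL2 hres) /
  `…_of_prop414_of_residualSurj''` (h414 htors hres).
* §4 `λ` READ OFF the Selmer group: `pow_lambdaInvariant_eq_natCard_selmer_torsion`
  (`p^{λ(X)} = #Sel_∞[p]` under `μ = 0` + no finite submodule — EPW Thm. 3.1.1's shape, image-free),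
  `finite_selmer_torsion_of_mu_zero_of_forall_finite_eq_bot`,
  `le_lambdaInvariant_iff_pow_le_natCard_selmer_torsion` (the budget IS the residual count).

References: L. Washington, GTM 83 (1997) §13.2 [Washington1997]; R. Greenberg, LNM 1716 (1999) §1
p. 60, Prop. 4.14 [GreenbergLNM1716]; Y. Hachimori, K. Matsuno, Proc. AMS 128 (2000) Cor. (i)
[HachimoriMatsuno2000]; M. Emerton, R. Pollack, T. Weston, Invent. Math. 163 (2006) Cor. 3.2.5 (source
of the residual count on irreducible rows only) [EmertonPollackWeston2006].
-/

set_option autoImplicit false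

noncomputable section

open scoped Classical AddSubgroup

open Literature.NumberTheory.EllipticCurves IwasawaAlgebra

namespace Summit.BirchSwinnertonDyer.Rank1Residual.Additive

open Summit.BirchSwinnertonDyer.Rank1Residual.Iwasawa WeierstrassCurve

variable (p : ℕ) [hp : Fact p.Prime]

/-! ### §1 (L1) -/

/-- **(L1) IS A THEOREM: `card_quotient_eq_pow_lambdaInvariant p M` holds for EVERY `Λ`-module `M`.**
For `M` finitely generated and torsion over `Λ = ℤ_p⟦T⟧` with `μ(M) = 0` and no nonzero finite
`Λ`-submodule: `μ = 0 ⟹ M` f.g. over `ℤ_p` (`muInvariant_eq_zero_iff_finite`) ⟹ `ℤ_p`-free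
(`free_of_forall_finite_eq_bot`) of rank `λ(M) = dim_{ℚ_p} ℚ_p ⊗ M` (`Module.finrank_baseChange`) ⟹
`#(M/𝔭M) = p^{λ(M)}` (`natCard_quotient_augIdealP_smul_top_eq_pow_finrank`). Discharges the `hL1`
binder of cc-typer-2's budget schema (`CongruentPartnerBudgetSchema.lean`).
[cite: Washington1997, §13.2 (after Thm. 13.12) and Prop. 13.8] -/
theorem card_quotient_eq_pow_lambdaInvariant_holds (M : Type*) [AddCommGroup M]
    [Module (IwasawaAlgebra p) M] : card_quotient_eq_pow_lambdaInvariant p M := by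
  intro _ hT hμ hnf
  letI : Module ℤ_[p] M := Module.compHom M (algebraMap ℤ_[p] (IwasawaAlgebra p))
  haveI : IsScalarTower ℤ_[p] (IwasawaAlgebra p) M := IsScalarTower.of_compHom ℤ_[p] _ M
  haveI hfg : Module.Finite ℤ_[p] M := (muInvariant_eq_zero_iff_finite p M hT).mp hμ
  haveI hfree : Module.Free ℤ_[p] M := free_of_forall_finite_eq_bot p (M := M) hnf
  -- the `ℤ_p`-structure of `RestrictScalars ℤ_p Λ M` IS the one just installed (definitionally)
  haveI : Module.Finite ℤ_[p] (RestrictScalars ℤ_[p] (IwasawaAlgebra p) M) := hfg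
  haveI : Module.Free ℤ_[p] (RestrictScalars ℤ_[p] (IwasawaAlgebra p) M) := hfree
  have hlam : lambdaInvariant p M = Module.finrank ℤ_[p] M :=
    lambdaInvariant_eq_finrank_of_free p M
  rw [hlam]
  exact natCard_quotient_augIdealP_smul_top_eq_pow_finrank p (M := M)

/-! ### §2 (L2) -/

/-- **(L2) IS A THEOREM: `#(X/𝔭X) = #Sel_{p^∞}(E/ℚ_∞)[p]` for EVERY Pontryagin-dual datum `D`** (both
sides `0` when infinite): `X/𝔭X = X/pX ≅ Hom(Sel_∞, ℚ/ℤ)/p` along `toDual` (`modNEquiv`)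
`≅ Hom(Sel_∞[p], ℚ/ℤ)` (`exists_restrictModN_bijective`), and `#Hom(A, ℚ/ℤ) = #A`. Discharges the `hL2`
binder of cc-typer-2's budget schema (`CongruentPartnerBudgetSchema.lean`).
[cite: GreenbergLNM1716, §1 p. 60 (X as the Pontryagin dual; shape only)] -/
theorem card_quotient_eq_card_selmer_torsion_holds (W : WeierstrassCurve ℚ) [W.IsElliptic]
    [W.IsGloballyMinimal] (κ : ZpExtension ℚ p) (γ : Field.absoluteGaloisGroup ℚ) :
    card_quotient_eq_card_selmer_torsion p W κ γ := by
  intro D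
  let Ψ : D.X ≃+ CharacterModule (W.selmerInfty κ) := AddEquiv.ofBijective D.toDual D.bijective
  rw [natCard_quotient_augIdealP_smul_top_eq_natCard_modN p,
    Nat.card_congr (modNEquiv Ψ p).toEquiv, natCard_modN_characterModule_eq]
  exact Nat.card_congr (Equiv.subtypeEquivRight fun s ↦ AddSubgroup.torsionBy.nsmul_iff)

/-! ### §3 The budget schema with the folklore binders supplied -/

/-- **T-E3gX3-bud SCHEMA, `hL1`-free:** (b′) no finite submodule + the dual-side residual count
`p ^ b ≤ #(X/𝔭X)` ⟹ `BudgetLeLambdaAt p W b` — cc-typer-2's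
`budgetLeLambdaAt_of_noFiniteSubmodule_of_residualRankGe` with (L1) supplied by §2. -/
theorem budgetLeLambdaAt_of_noFiniteSubmodule_of_residualRankGe' {W : WeierstrassCurve ℚ}
    [W.IsElliptic] [W.IsGloballyMinimal] {b : ℕ}
    (hnf : NoFiniteSubmoduleAt p W) (hres : ResidualRankGeAt p W b) : BudgetLeLambdaAt p W b :=
  budgetLeLambdaAt_of_noFiniteSubmodule_of_residualRankGe
    (fun M _ _ ↦ card_quotient_eq_pow_lambdaInvariant_holds p M) hnf hres

/-- **T-E3gX3-bud SCHEMA under the lead's name, `hL1`-free:** (b′) + (L2) + the Selmer-side residual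
count `p ^ b ≤ #Sel_{p^∞}(E/ℚ_∞)[p]` ⟹ `BudgetLeLambdaAt p W b`. Remaining typed inputs: (L2) (Pontryagin
folklore) and `ResidualSelmerRankGeAt` (flag `X3-budget-unprinted` on reducible rows). -/
theorem budgetLeLambdaAt_of_noFiniteSubmodule_of_residualSurj' {W : WeierstrassCurve ℚ}
    [W.IsElliptic] [W.IsGloballyMinimal] {b : ℕ}
    (hL2 : ∀ (κ : ZpExtension ℚ p) (γ : Field.absoluteGaloisGroup ℚ),
      card_quotient_eq_card_selmer_torsion p W κ γ)
    (hnf : NoFiniteSubmoduleAt p W) (hres : ResidualSelmerRankGeAt p W b) : BudgetLeLambdaAt p W b :=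
  budgetLeLambdaAt_of_noFiniteSubmodule_of_residualSurj
    (fun M _ _ ↦ card_quotient_eq_pow_lambdaInvariant_holds p M) hL2 hnf hres

/-- **T-E3gX3-bud SCHEMA on rows with `p ∤ #E(ℚ)_tors`, `hL1`-free:** the Greenberg-1999 Prop. 4.14
record BY NAME + (L2) + the ONE arithmetic input `ResidualSelmerRankGeAt p W b` ⟹ `BudgetLeLambdaAt p W b`.
[cite: GreenbergLNM1716, Prop. 4.14 (§4)] [cite: HachimoriMatsuno2000, Corollary (i)] -/
theorem budgetLeLambdaAt_of_prop414_of_residualSurj' {W : WeierstrassCurve ℚ} [W.IsElliptic]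
    [W.IsGloballyMinimal] {b : ℕ}
    (h414 : Greenberg1999.prop414_noFiniteSubmodule_of_not_dvd_torsionOrder)
    (htors : ¬ p ∣ W.torsionOrder)
    (hL2 : ∀ (κ : ZpExtension ℚ p) (γ : Field.absoluteGaloisGroup ℚ),
      card_quotient_eq_card_selmer_torsion p W κ γ)
    (hres : ResidualSelmerRankGeAt p W b) : BudgetLeLambdaAt p W b :=
  budgetLeLambdaAt_of_prop414_of_residualSurj h414 htors
    (fun M _ _ ↦ card_quotient_eq_pow_lambdaInvariant_holds p M) hL2 hres

/-- **T-E3gX3-bud SCHEMA, binder-free algebra:** (b′) `NoFiniteSubmoduleAt p W` + the Selmer-side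
residual count `p ^ b ≤ #Sel_{p^∞}(E/ℚ_∞)[p]` ⟹ `BudgetLeLambdaAt p W b` — cc-typer-2's
`budgetLeLambdaAt_of_noFiniteSubmodule_of_residualSurj` with (L1) (`MuZeroQuotientCard.lean`) AND (L2)
supplied. The ONLY inputs left are arithmetic: (b′) and `ResidualSelmerRankGeAt p W b`. -/
theorem budgetLeLambdaAt_of_noFiniteSubmodule_of_residualSurj'' {W : WeierstrassCurve ℚ}
    [W.IsElliptic] [W.IsGloballyMinimal] {b : ℕ}
    (hnf : NoFiniteSubmoduleAt p W) (hres : ResidualSelmerRankGeAt p W b) : BudgetLeLambdaAt p W b :=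
  budgetLeLambdaAt_of_noFiniteSubmodule_of_residualSurj' p
    (card_quotient_eq_card_selmer_torsion_holds p W) hnf hres

/-- **T-E3gX3-bud SCHEMA on rows with `p ∤ #E(ℚ)_tors`, binder-free algebra:** the Greenberg-1999
Prop. 4.14 record BY NAME + the ONE arithmetic input `ResidualSelmerRankGeAt p W b` ⟹
`BudgetLeLambdaAt p W b` (no (L1), no (L2)). [cite: GreenbergLNM1716, Prop. 4.14 (§4)]
[cite: HachimoriMatsuno2000, Corollary (i)] -/
theorem budgetLeLambdaAt_of_prop414_of_residualSurj'' {W : WeierstrassCurve ℚ} [W.IsElliptic]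
    [W.IsGloballyMinimal] {b : ℕ}
    (h414 : Greenberg1999.prop414_noFiniteSubmodule_of_not_dvd_torsionOrder)
    (htors : ¬ p ∣ W.torsionOrder) (hres : ResidualSelmerRankGeAt p W b) : BudgetLeLambdaAt p W b :=
  budgetLeLambdaAt_of_prop414_of_residualSurj' p h414 htors
    (card_quotient_eq_card_selmer_torsion_holds p W) hres

/-! ### §4 `λ` READ OFF the Selmer group: `p^{λ(X)} = #Sel_{p^∞}(E/ℚ_∞)[p]` ((L1) + (L2)) -/

/-- **`p ^ λ(X(E/ℚ_∞)) = #Sel_{p^∞}(E/ℚ_∞)[p]`** for every cyclotomic Pontryagin-dual datum `D` with `X`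
finitely generated and `Λ`-torsion, `μ = 0` and no nonzero finite `Λ`-submodule — (L1) and (L2)
together; the image-free shape of Emerton–Pollack–Weston 2006 Thm. 3.1.1 ("`λ = dim_k Sel[π]` when
`μ = 0` and there are no finite submodules"). So the budget input `b ≤ λ` IS the residual count
`p^b ≤ #Sel_∞[p]` on such rows, neither more nor less. (`Nat.card`; the right side is then a power of
`p`, in particular finite and non-zero.) [cite: EmertonPollackWeston2006, Thm. 3.1.1 (shape; image-free here)]
[cite: Washington1997, §13.2 (after Thm. 13.12)] -/
theorem pow_lambdaInvariant_eq_natCard_selmer_torsion {W : WeierstrassCurve ℚ} [W.IsElliptic]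
    [W.IsGloballyMinimal] {κ : ZpExtension ℚ p} {γ : Field.absoluteGaloisGroup ℚ}
    (D : W.SelmerDualData κ γ) [Module.Finite (IwasawaAlgebra p) D.X] (hXt : D.IsTorsion)
    (hμ : D.mu = 0) (hnf : ∀ N : Submodule (IwasawaAlgebra p) D.X, Finite N → N = ⊥) :
    p ^ lambdaInvariant p D.X = Nat.card {s : W.selmerInfty κ // p • s = 0} := by
  rw [← card_quotient_eq_pow_lambdaInvariant_holds p D.X hXt hμ hnf]
  exact card_quotient_eq_card_selmer_torsion_holds p W κ γ D

/-- Hence, on such rows, **`Sel_{p^∞}(E/ℚ_∞)[p]` is FINITE** (its `Nat.card` is a power of `p`, not `0`).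
[cite: Washington1997, §13.2 (after Thm. 13.12)] -/
theorem finite_selmer_torsion_of_mu_zero_of_forall_finite_eq_bot {W : WeierstrassCurve ℚ}
    [W.IsElliptic] [W.IsGloballyMinimal] {κ : ZpExtension ℚ p} {γ : Field.absoluteGaloisGroup ℚ}
    (D : W.SelmerDualData κ γ) [Module.Finite (IwasawaAlgebra p) D.X] (hXt : D.IsTorsion)
    (hμ : D.mu = 0) (hnf : ∀ N : Submodule (IwasawaAlgebra p) D.X, Finite N → N = ⊥) :
    Finite {s : W.selmerInfty κ // p • s = 0} := by
  apply Nat.finite_of_card_ne_zero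
  rw [← pow_lambdaInvariant_eq_natCard_selmer_torsion p D hXt hμ hnf]
  exact pow_ne_zero _ hp.out.ne_zero

/-- **The budget is EXACTLY the residual count on such rows**: for `D` as above,
`b ≤ λ(X) ↔ p ^ b ≤ #Sel_{p^∞}(E/ℚ_∞)[p]`. [cite: Washington1997, §13.2 (after Thm. 13.12)] -/
theorem le_lambdaInvariant_iff_pow_le_natCard_selmer_torsion {W : WeierstrassCurve ℚ} [W.IsElliptic]
    [W.IsGloballyMinimal] {κ : ZpExtension ℚ p} {γ : Field.absoluteGaloisGroup ℚ}
    (D : W.SelmerDualData κ γ) [Module.Finite (IwasawaAlgebra p) D.X] (hXt : D.IsTorsion)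
    (hμ : D.mu = 0) (hnf : ∀ N : Submodule (IwasawaAlgebra p) D.X, Finite N → N = ⊥) (b : ℕ) :
    b ≤ lambdaInvariant p D.X ↔ p ^ b ≤ Nat.card {s : W.selmerInfty κ // p • s = 0} := by
  rw [← pow_lambdaInvariant_eq_natCard_selmer_torsion p D hXt hμ hnf]
  exact (Nat.pow_le_pow_iff_right hp.out.one_lt).symm

end Summit.BirchSwinnertonDyer.Rank1Residual.Additive

end
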